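import Summits.QuantumAdvantage.QuantumAdvantage.Theorems.NearExactIsExact.Negative.SmallCasesWalsh

/-!
# `NearExactIsExact` (stmt-QuantumAdvantage-14043), negative side — the pure g-side census CENSUS₁₀ is FALSE

`Theorems/CubicForrelationNearExactIsExactTenIsolation78.lean` proves `isolation_ten_78_of_census : CENSUS₁₀ → (7/8-isolation
for cubic pairs on 10 bits)`, where CENSUS₁₀ says that the 8-bit cell congruence system of `ten_unbalanced_cells` (heavy cells
`≡ 8 (mod 16)`, light cells `≡ 4 (mod 8)`, `Q` unbalanced of bias `< 128`) has NO solution `(E, D, Q, bh)` with `E` cubic and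
`D, Q` quadratic.  This file exhibits an explicit solution, found by the certifier's independent census (kit job `j028094`,
refuter-ccert gen 2; the lead's own census found the same phenomenon, crux NOTES c6 part 5):

* `Q₀ = w₀w₁ ⊕ w₂w₃ ⊕ w₄w₅` (Dickson type `h = 3`, bias `+32`), `D₀ = w₀w₂ ⊕ w₁w₃ ⊕ w₀ ⊕ w₄`, `bh = false`,
* `E₀` = the XOR of the 33 monomials `E0monos` (7 quadratic, 26 cubic),

and all `2 · 2 · 256` cell sums are checked by `native_decide` on an integer transcription (`cellZ`, bridged to the real sums of
the statement by `cell_sum_eq`).  Consequently `¬ CENSUS₁₀` (`not_census10`): the hypothesis of `isolation_ten_78_of_census` is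
unsatisfiable and only the corrected proposition CENSUS₁₀′ of `isolation_ten_78_of_census2` (which also quantifies over the cubic
partner `f₁`) can certify `n = 10`; for this witness every cubic partner has `Φ ≤ 7/8` (`Φ > 7/8` would need a word of `RM(3,9)`
within Hamming distance `17` of the heavy sign word, and Reed majority decoding — exact below the unique-decoding radius `32` —
returns a codeword at distance `218`, so none is within `31`; census evidence on the item).  Axioms: the standard three plus
`Lean.ofReduceBool` for the one `native_decide` table check (`checkWitness_eq_true`).
-/

set_option linter.dupNamespace false -- D-0017: single-problem summit ⇒ `QuantumAdvantage.QuantumAdvantage` by design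

namespace Summit.QuantumAdvantage.QuantumAdvantage.Theorems.NearExactIsExact.Negative.Census10

open Finset
open Literature.Computability.QuantumComplexity
open Summit.QuantumAdvantage.QuantumAdvantage.Theorems.SignedExactSliceIsLift
open Summit.QuantumAdvantage.QuantumAdvantage.Theorems.SignedExactSliceIsLift.StubMoebius
open Summit.QuantumAdvantage.QuantumAdvantage.Theorems.NearExactIsExact.Negative.SmallCases

/-! ### The witness -/

/-- The 33 monomials of the cubic `E₀` (index sets of coordinates of `𝔽₂⁸`). [this work, census j028094] -/
def E0monos : List (List ℕ) :=
  [[0, 2], [1, 2], [3, 4], [1, 6], [5, 6], [3, 7], [4, 7], [0, 1, 3], [0, 2, 3], [1, 2, 3], [0, 1, 5], [0, 2, 5], [1, 3, 5],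
   [2, 3, 5], [0, 4, 5], [1, 4, 5], [2, 4, 5], [0, 1, 6], [0, 3, 6], [2, 3, 6], [0, 4, 6], [2, 4, 6], [1, 5, 6], [2, 5, 6],
   [3, 5, 6], [0, 2, 7], [1, 2, 7], [0, 3, 7], [1, 3, 7], [2, 3, 7], [0, 4, 7], [1, 5, 7], [4, 5, 7]]

/-- `E₀ = ⊕_{S ∈ E0monos} ∏_{i ∈ S} wᵢ`. [this work] -/
def E₀ (w : Fin 8 → Bool) : Bool := evalMonos 8 E0monos w

/-- `D₀ = w₀w₂ ⊕ w₁w₃ ⊕ w₀ ⊕ w₄`. [this work] -/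
def D₀ (w : Fin 8 → Bool) : Bool :=
  xor (xor (xor ([0, 2].all (litVal 8 w)) ([1, 3].all (litVal 8 w))) ([0].all (litVal 8 w))) ([4].all (litVal 8 w))

/-- `Q₀ = w₀w₁ ⊕ w₂w₃ ⊕ w₄w₅` (Dickson normal form, `h = 3`). [cite: MacWilliamsSloane1977, Ch. 15 §2 Thm. 4] -/
def Q₀ (w : Fin 8 → Bool) : Bool :=
  xor (xor ([0, 1].all (litVal 8 w)) ([2, 3].all (litVal 8 w))) ([4, 5].all (litVal 8 w))

/-- `E₀` is cubic. [cite: Carlet2020, §2.2.1 Def. 6] -/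
theorem isDegLeFun_E₀ : IsDegLeFun 3 E₀ := isDegLeFun_evalMonos E0monos

/-- `D₀` is quadratic. [cite: Carlet2020, §2.2.1 Def. 6] -/
theorem isDegLeFun_D₀ : IsDegLeFun 2 D₀ :=
  isDegLeFun_xor (isDegLeFun_xor (isDegLeFun_xor (isDegLeFun_all [0, 2]) (isDegLeFun_all [1, 3]))
    ((isDegLeFun_all [0]).mono (by decide))) ((isDegLeFun_all [4]).mono (by decide))

/-- `Q₀` is quadratic. [cite: Carlet2020, §2.2.1 Def. 6] -/
theorem isDegLeFun_Q₀ : IsDegLeFun 2 Q₀ :=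
  isDegLeFun_xor (isDegLeFun_xor (isDegLeFun_all [0, 1]) (isDegLeFun_all [2, 3])) (isDegLeFun_all [4, 5])

/-! ### Integer transcription of the cell sums and the table check -/

/-- The cell sum `Σ_{w : D w = a, Q w = b} (-1)^{E w + w·y}` on codes. [folklore] -/
def cellZ (E D Q : (Fin 8 → Bool) → Bool) (a b : Bool) (y : ℕ) : ℤ :=
  ∑ k ∈ range 256, if (D (pt 8 k) = a ∧ Q (pt 8 k) = b) then sgnZ (E (pt 8 k)) * chi 8 k y else 0

/-- The real cell sum of the census statement is the integer one at the code of `x`. [folklore] -/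
theorem cell_sum_eq (E D Q : (Fin 8 → Bool) → Bool) (a b : Bool) (y : ℕ) :
    (∑ w : Fin (4 + 4) → Bool, if (D w = a ∧ Q w = b) then signOf (E w) * twist w (pt 8 y) else 0) =
      (cellZ E D Q a b y : ℝ) := by
  unfold cellZ
  rw [sum_pt 8]
  push_cast
  refine sum_congr rfl fun k _ => ?_
  split_ifs
  · rw [signOf_eq_cast, twist_pt]
  · rfl

/-- The bias of `Q₀` on codes. [folklore] -/
theorem bias_sum_eq : (∑ w : Fin (4 + 4) → Bool, signOf (Q₀ w)) = ((∑ k ∈ range 256, sgnZ (Q₀ (pt 8 k)) : ℤ) : ℝ) := by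
  rw [sum_pt 8]
  push_cast
  exact sum_congr rfl fun k _ => signOf_eq_cast _

/-- The bias of `Q₀` is `32`. [this work] -/
theorem biasZ_eq : (∑ k ∈ range 256, sgnZ (Q₀ (pt 8 k))) = 32 := by
  decide +kernel

/-- The finite check: heavy cells (`Q₀ = false`) have all sums `≡ 8 (mod 16)`, light cells all sums `≡ 4 (mod 8)`. [this work] -/
def checkWitness : Bool :=
  (List.range 256).all fun y =>
    ([false, true].all fun a => cellZ E₀ D₀ Q₀ a false y % 16 == 8) &&
    ([false, true].all fun a => cellZ E₀ D₀ Q₀ a true y % 8 == 4)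

/-- The table check passes (native evaluation of `2 · 2 · 256` integer cell sums). [this work, computational] -/
theorem checkWitness_eq_true : checkWitness = true := by
  native_decide

/-- Heavy cells of the witness: every sum is `8·(odd)`. [this work] -/
theorem heavy_witness (a : Bool) (x : Fin (4 + 4) → Bool) :
    ∃ k : ℤ, (∑ w : Fin (4 + 4) → Bool, if (D₀ w = a ∧ Q₀ w = false) then signOf (E₀ w) * twist w x else 0) =
      8 * (2 * (k : ℝ) + 1) := by
  obtain ⟨y, hy, rfl⟩ : ∃ y, y < 256 ∧ x = pt 8 y := ⟨codeOf x, codeOf_lt x, (pt_codeOf x).symm⟩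
  have h := checkWitness_eq_true
  simp only [checkWitness, List.all_eq_true, Bool.and_eq_true, List.mem_range] at h
  have hmod : cellZ E₀ D₀ Q₀ a false y % 16 = 8 := by
    have := (h y hy).1 a (by cases a <;> simp)
    simpa using this
  refine ⟨cellZ E₀ D₀ Q₀ a false y / 16, ?_⟩
  rw [cell_sum_eq]
  have e : cellZ E₀ D₀ Q₀ a false y = 8 + 16 * (cellZ E₀ D₀ Q₀ a false y / 16) := by omega
  have e' : (cellZ E₀ D₀ Q₀ a false y : ℝ) = 8 + 16 * ((cellZ E₀ D₀ Q₀ a false y / 16 : ℤ) : ℝ) := by exact_mod_cast e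
  rw [e']
  ring

/-- Light cells of the witness: every sum is `4·(odd)`. [this work] -/
theorem light_witness (a : Bool) (x : Fin (4 + 4) → Bool) :
    ∃ k : ℤ, (∑ w : Fin (4 + 4) → Bool, if (D₀ w = a ∧ Q₀ w = !false) then signOf (E₀ w) * twist w x else 0) =
      4 * (2 * (k : ℝ) + 1) := by
  obtain ⟨y, hy, rfl⟩ : ∃ y, y < 256 ∧ x = pt 8 y := ⟨codeOf x, codeOf_lt x, (pt_codeOf x).symm⟩
  have h := checkWitness_eq_true
  simp only [checkWitness, List.all_eq_true, Bool.and_eq_true, List.mem_range] at h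
  have hmod : cellZ E₀ D₀ Q₀ a true y % 8 = 4 := by
    have := (h y hy).2 a (by cases a <;> simp)
    simpa using this
  refine ⟨cellZ E₀ D₀ Q₀ a true y / 8, ?_⟩
  rw [show (!false) = true from rfl, cell_sum_eq]
  have e : cellZ E₀ D₀ Q₀ a true y = 4 + 8 * (cellZ E₀ D₀ Q₀ a true y / 8) := by omega
  have e' : (cellZ E₀ D₀ Q₀ a true y : ℝ) = 4 + 8 * ((cellZ E₀ D₀ Q₀ a true y / 8 : ℤ) : ℝ) := by exact_mod_cast e
  rw [e']
  ring

/-- The bias of `Q₀` is nonzero and `< 128` in absolute value. [this work] -/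
theorem bias_witness : (∑ w : Fin (4 + 4) → Bool, signOf (Q₀ w)) ≠ 0 ∧ |∑ w : Fin (4 + 4) → Bool, signOf (Q₀ w)| < 128 := by
  rw [bias_sum_eq, biasZ_eq]
  norm_num

/-! ### CENSUS₁₀ is false -/

/-- **A solution of the pure g-side cell system.** `(E₀, D₀, Q₀, false)` satisfies every hypothesis of the finite proposition
CENSUS₁₀ of `isolation_ten_78_of_census`. [this work, census j028094] -/
theorem census10_gside_solution :
    ∃ (E D Q : (Fin (4 + 4) → Bool) → Bool) (bh : Bool), IsDegLeFun 3 E ∧ IsDegLeFun 2 D ∧ IsDegLeFun 2 Q ∧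
      (∑ w, signOf (Q w)) ≠ 0 ∧ |∑ w, signOf (Q w)| < 128 ∧
      (∀ (a : Bool) (x : Fin (4 + 4) → Bool), ∃ k : ℤ,
        (∑ w : Fin (4 + 4) → Bool, if (D w = a ∧ Q w = bh) then signOf (E w) * twist w x else 0) = 8 * (2 * (k : ℝ) + 1)) ∧
      (∀ (a : Bool) (x : Fin (4 + 4) → Bool), ∃ k : ℤ,
        (∑ w : Fin (4 + 4) → Bool, if (D w = a ∧ Q w = !bh) then signOf (E w) * twist w x else 0) = 4 * (2 * (k : ℝ) + 1)) :=
  ⟨E₀, D₀, Q₀, false, isDegLeFun_E₀, isDegLeFun_D₀, isDegLeFun_Q₀, bias_witness.1, bias_witness.2, heavy_witness, light_witness⟩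

/-- **CENSUS₁₀ is false**: the hypothesis of `isolation_ten_78_of_census` (no solution of the pure g-side cell system) is
unsatisfiable, verbatim. Hence the `n = 10`, `θ = 7/8` case must go through CENSUS₁₀′ (`isolation_ten_78_of_census2`), which
also quantifies over the cubic partner. [this work, census j028094] -/
theorem not_census10 :
    ¬ (∀ (E D Q : (Fin (4 + 4) → Bool) → Bool) (bh : Bool), IsDegLeFun 3 E → IsDegLeFun 2 D → IsDegLeFun 2 Q →
      (∑ w, signOf (Q w)) ≠ 0 → |∑ w, signOf (Q w)| < 128 →
      (∀ (a : Bool) (x : Fin (4 + 4) → Bool), ∃ k : ℤ,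
        (∑ w : Fin (4 + 4) → Bool, if (D w = a ∧ Q w = bh) then signOf (E w) * twist w x else 0) = 8 * (2 * (k : ℝ) + 1)) →
      (∀ (a : Bool) (x : Fin (4 + 4) → Bool), ∃ k : ℤ,
        (∑ w : Fin (4 + 4) → Bool, if (D w = a ∧ Q w = !bh) then signOf (E w) * twist w x else 0) = 4 * (2 * (k : ℝ) + 1)) →
      False) := by
  intro h
  obtain ⟨E, D, Q, bh, hE, hD, hQ, h1, h2, hH, hL⟩ := census10_gside_solution
  exact h E D Q bh hE hD hQ h1 h2 hH hL

end Summit.QuantumAdvantage.QuantumAdvantage.Theorems.NearExactIsExact.Negative.Census10
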